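import Mathlib
import HarnessLib
import Literature.Analysis.FluidPDE.VectorCalculus
import Summits.NavierStokesRegularity.NavierStokesRegularity.Theorems.UnthreadedRigidityDoorUnthreadedRigidityVirialHornZonal
import Summits.NavierStokesRegularity.NavierStokesRegularity.Theorems.UnthreadedRigidityDoorUnthreadedRigidityVirialHornShellDecay
import Summits.NavierStokesRegularity.NavierStokesRegularity.Theorems.UnthreadedRigidityDoorUnthreadedRigidityVirialHornAngularLemma
import Summits.NavierStokesRegularity.NavierStokesRegularity.Theorems.UnthreadedRigidityDoorUnthreadedRigidityCoZonalDefs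

/-!
# Route `UnthreadedRigidityDoor`, item `UnthreadedRigidity` (W2, stmt-NavierStokesRegularity-27585) — LINE g12-1 «CO-ZONAL DICHOTOMY»:
# the supports `PbrHomogeneous` and Z⁺ `CoZonalShellAxisym` BY NAME (KEY-NS #205 (b))

Prover file (engine-1 g71; `--supports stmt-NavierStokesRegularity-27585 --as helper`) for LINE g12-1 of planner ns-idea-6 g12 (objects BY NAME in
`…CoZonalDefs.lean`).
* ★ `pbrHomogeneous_holds : PbrHomogeneous` — `{Y₁,Y₂}(cy) = c^{l₁+l₂−1}{Y₁,Y₂}(y)` (`∇Yᵢ(cy) = c^{lᵢ−1}∇Yᵢ(y)`, `IsSolidHarmonic.gradient_smul`,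
  and trilinearity of `det3`);
* `zonalShell_fderiv_generator` — g11-1's S-Z proof (`zonalShellAxisym_holds`, ns-crc-p1 g7) with the Householder frame `P` (`P e₂ = a/|a|`) taken
  as an INPUT: the shell `curl curl (H(|y|)Y(y) y)` with `Y` zonal about `a` satisfies `D u₀(x)[A(x−x₀)] = A u₀(x)` for the FIXED generator
  `A = P ∘ rotGen ∘ P⁻¹`;
* ★ `coZonalShellAxisym_holds : CoZonalShellAxisym` (Z⁺) — two shells zonal about one axis share that generator; the identity is linear in the field.
* ★ LEMMA R `IsSolidHarmonic.eq_zero_of_rot_eventuallyEq_zero` — a solid harmonic of degree `≥ 1` whose rotation field `y × ∇Y` vanishes near a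
  point is `≡ 0` (`|y|²∇Y = lY·y` there; differentiate, take the trace: `−l(l+1)Y = 0`; analyticity) — the tool for CZ-b `ZonalAxesMatch` (next file).

HONEST LABEL: supports of a RUNG line about SPECIAL two-shell data; `UnthreadedRigidity` (27585), W2 and NS regularity remain OPEN; nothing here is a
statement about the Navier–Stokes equations.  0 kit.
-/

-- the summit and its single sub-problem share the name (CONVENTIONS §1), as in every Theorems file
set_option linter.dupNamespace false

namespace Summit.NavierStokesRegularity.NavierStokesRegularity.Theorems.UnthreadedRigidity.CoZonal

open Summit.NavierStokesRegularity.NavierStokesRegularity.Theorems.UnthreadedRigidity.VirialHorn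
open Summit.NavierStokesRegularity.NavierStokesRegularity.Theorems.UnthreadedRigidity.ProfileHorn (E3 IsSliceAxisymmetric)
open Summit.NavierStokesRegularity.NavierStokesRegularity.Theorems.UnthreadedRigidity.ThreadingJets (fluxJetOne)

/-! ## `PbrHomogeneous` BY NAME -/

section Homogeneity

/-- `det3` is trilinear: scalars pull out of each slot. -/
private theorem det3_smul_three (s a b : ℝ) (y u w : E3) :
    det3 (s • y) (a • u) (b • w) = s * a * b * det3 y u w := by
  simp only [det3, PiLp.smul_apply, smul_eq_mul]
  ring

/-- ★ **`PbrHomogeneous`** (support S of LINE g12-1): the bracket `{Y₁,Y₂} = det[y, ∇Y₁, ∇Y₂]` of solid harmonics of degrees `l₁, l₂ ≥ 1` is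
homogeneous of degree `l₁ + l₂ − 1` (`∇Yᵢ(c y) = c^{lᵢ−1} ∇Yᵢ(y)`, `IsSolidHarmonic.gradient_smul`). -/
theorem pbrHomogeneous_holds : PbrHomogeneous := by
  intro l₁ l₂ Y₁ Y₂ hl₁ hl₂ hY₁ hY₂ c y hc
  obtain ⟨k₁, rfl⟩ : ∃ k, l₁ = k + 1 := ⟨l₁ - 1, by omega⟩
  obtain ⟨k₂, rfl⟩ : ∃ k, l₂ = k + 1 := ⟨l₂ - 1, by omega⟩
  have h1 : gradient Y₁ (c • y) = c ^ k₁ • gradient Y₁ y := by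
    rw [hY₁.gradient_smul c hc y]
    congr 1
    rw [show ((k₁ + 1 : ℕ) : ℤ) - 1 = (k₁ : ℤ) by push_cast; ring, zpow_natCast]
  have h2 : gradient Y₂ (c • y) = c ^ k₂ • gradient Y₂ y := by
    rw [hY₂.gradient_smul c hc y]
    congr 1
    rw [show ((k₂ + 1 : ℕ) : ℤ) - 1 = (k₂ : ℤ) by push_cast; ring, zpow_natCast]
  unfold pbr
  rw [h1, h2, det3_smul_three, show k₁ + 1 + (k₂ + 1) - 1 = k₁ + k₂ + 1 by omega]
  ring

end Homogeneity

/-! ## Z⁺ `CoZonalShellAxisym` BY NAME — S-Z with the generator NAMED (one Householder frame for the common axis), summed -/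

section Axisym

open scoped Topology ContDiff InnerProductSpace
open Filter Set
open Literature.Analysis.FluidPDE
open Summit.NavierStokesRegularity.NavierStokesRegularity.Theorems.UnthreadedRigidity.ProfileHorn (exists_isometry_map_single_two rotZ_single_two' inner_rotGen_self_zero)
open Summit.NavierStokesRegularity.NavierStokesRegularity.Theorems.AxisymEndLiouville.AbsorbingAxisSwirlExtinction (hasDerivAt_rotZ_rotGen)

/-- THE GENERATOR NAMED: for a unit axis `n`, an isometry `P` with `P e₂ = n`, a solid harmonic `Y` zonal about `n`'s direction and a smooth-even
profile, the shell `curl curl (H(|y|) Y(y) y)` about `x₀` satisfies the infinitesimal axisymmetry identity for the FIXED generator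
`A = P ∘ rotGen ∘ P⁻¹` (the body of g11-1's `zonalShellAxisym_holds`, with the frame taken as an input instead of chosen inside). -/
theorem zonalShell_fderiv_generator {l : ℕ} {H h : ℝ → ℝ} {Y : E3 → ℝ} {a : E3} (x₀ : E3) (hY : IsSolidHarmonic l Y) (ha : a ≠ 0)
    (hza : IsZonalAbout a Y) (hh : ContDiff ℝ ∞ h) (hHh : ∀ r, 0 ≤ r → H r = h (r ^ 2))
    (P : E3 ≃ₗᵢ[ℝ] E3) (hP' : P (e 2) = ‖a‖⁻¹ • a) :
    ∀ x : E3, fderiv ℝ (sepShellL H Y x₀) x (P (rotGen (P.symm (x - x₀)))) = P (rotGen (P.symm (sepShellL H Y x₀ x))) := by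
  have hYs : ContDiff ℝ ∞ Y := hY.contDiff
  have hYd : Differentiable ℝ Y := hYs.differentiable (by simp)
  have han : ‖a‖ ≠ 0 := norm_ne_zero_iff.mpr ha
  set n : E3 := ‖a‖⁻¹ • a with hn_def
  have hPsymm : P.symm n = e 2 := by rw [← hP', LinearIsometryEquiv.symm_apply_apply]
  -- KEY: the derivative of `Y` along the conjugated generator vanishes
  have hkey : ∀ x : E3, fderiv ℝ Y x (P (rotGen (P.symm x))) = 0 := by
    intro x
    rw [← inner_gradient_left]
    have e1 : ⟪gradient Y x, P (rotGen (P.symm x))⟫_ℝ = ⟪P.symm (gradient Y x), rotGen (P.symm x)⟫_ℝ := by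
      conv_lhs => rw [← P.apply_symm_apply (gradient Y x)]
      rw [LinearIsometryEquiv.inner_map_map]
    rw [e1, inner_rotGen_eq_det3, ← hPsymm, hn_def, map_smul, det3_smul_left]
    have e2 : det3 (P.symm a) (P.symm x) (P.symm (gradient Y x))
        = det3 ((P.symm : E3 →L[ℝ] E3) (e 0)) ((P.symm : E3 →L[ℝ] E3) (e 1)) ((P.symm : E3 →L[ℝ] E3) (e 2))
          * det3 a x (gradient Y x) := det3_map (P.symm : E3 →L[ℝ] E3) a x (gradient Y x)
    rw [e2, hza x, mul_zero, mul_zero]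
  -- `Y ∘ P` is an axisymmetric scalar in the tree's sense
  have hYax : IsAxisymmetricScalar (fun z : E3 => Y (P z)) := by
    intro θ z
    have hdiff : Differentiable ℝ (fun θ : ℝ => Y (P (rotZ θ z))) := by
      intro θ
      exact ((hYd _).comp _ ((P : E3 →L[ℝ] E3).differentiableAt.comp _ (hasDerivAt_rotZ_rotGen z θ).differentiableAt))
    have hder : ∀ θ : ℝ, deriv (fun θ : ℝ => Y (P (rotZ θ z))) θ = 0 := by
      intro θ
      have h1 : HasDerivAt (fun θ : ℝ => P (rotZ θ z)) (P (rotGen (rotZ θ z))) θ :=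
        (P : E3 →L[ℝ] E3).hasFDerivAt.comp_hasDerivAt θ (hasDerivAt_rotZ_rotGen z θ)
      have h2 : HasDerivAt (fun θ : ℝ => Y (P (rotZ θ z))) (fderiv ℝ Y (P (rotZ θ z)) (P (rotGen (rotZ θ z)))) θ :=
        (hYd _).hasFDerivAt.comp_hasDerivAt θ h1
      rw [h2.deriv]
      have := hkey (P (rotZ θ z))
      rwa [LinearIsometryEquiv.symm_apply_apply] at this
    have := is_const_of_deriv_eq_zero hdiff hder θ 0
    simpa using this
  -- the conjugated potential field is axisymmetric
  set G₀ : E3 → E3 := fun y => (h (‖y‖ ^ 2) * Y y) • y with hG₀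
  have hG₀s : ContDiff ℝ ∞ G₀ := by
    have h1 : ContDiff ℝ ∞ (fun y : E3 => ‖y‖ ^ 2) := contDiff_norm_sq ℝ
    exact ((hh.comp h1).mul hYs).smul contDiff_id
  set Gt : E3 → E3 := fun z => P.symm (G₀ (P z)) with hGt
  have hGt_eq : ∀ z, Gt z = (h (‖z‖ ^ 2) * Y (P z)) • z := by
    intro z
    simp only [hGt, hG₀, map_smul, LinearIsometryEquiv.norm_map, LinearIsometryEquiv.symm_apply_apply]
  have hGt_ax : IsAxisymmetric Gt := by
    intro θ z
    have hY' : Y (P (rotZ θ z)) = Y (P z) := hYax θ z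
    rw [hGt_eq, hGt_eq, norm_rotZ, hY', ← rotZLIE_apply θ ((h (‖z‖ ^ 2) * Y (P z)) • z), map_smul, rotZLIE_apply]
  have hGts : ContDiff ℝ ∞ Gt := by
    simp only [hGt]
    exact (P.symm : E3 →L[ℝ] E3).contDiff.comp (hG₀s.comp (P : E3 →L[ℝ] E3).contDiff)
  have hGtd : Differentiable ℝ Gt := hGts.differentiable (by simp)
  have hcGt : ContDiff ℝ ∞ (curl Gt) := contDiff_curl (n := ⊤) (by simpa using hGts)
  have hcGtd : Differentiable ℝ (curl Gt) := hcGt.differentiable (by simp)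
  have hccGt : ContDiff ℝ ∞ (curl (curl Gt)) := contDiff_curl (n := ⊤) (by simpa using hcGt)
  have hccGtd : Differentiable ℝ (curl (curl Gt)) := hccGt.differentiable (by simp)
  have hax2 : IsAxisymmetric (curl (curl Gt)) := (hGt_ax.curl hGtd).curl hcGtd
  -- conjugation covariance of the double curl
  have hdet := det_linearIsometryEquiv_mul_self P.symm
  have hcurl1 : curl Gt = fun z => (P.symm : E3 →L[ℝ] E3).det • P.symm (curl G₀ (P z)) := by
    funext z
    have := curl_conj_linearIsometryEquiv P.symm G₀ z
    simp only [LinearIsometryEquiv.symm_symm] at this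
    simpa [hGt] using this
  have hcurl2 : curl (curl Gt) = fun z => P.symm (curl (curl G₀) (P z)) := by
    funext z
    rw [hcurl1]
    have e1 : (fun z => (P.symm : E3 →L[ℝ] E3).det • P.symm (curl G₀ (P z)))
        = fun z => P.symm (((P.symm : E3 →L[ℝ] E3).det • curl G₀) (P z)) := by
      funext w; simp [map_smul]
    rw [e1]
    have := curl_conj_linearIsometryEquiv P.symm ((P.symm : E3 →L[ℝ] E3).det • curl G₀) z
    simp only [LinearIsometryEquiv.symm_symm] at this
    rw [this]
    have e2 : curl ((P.symm : E3 →L[ℝ] E3).det • curl G₀) (P z) = (P.symm : E3 →L[ℝ] E3).det • curl (curl G₀) (P z) := by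
      have := curl_const_smul_field ((P.symm : E3 →L[ℝ] E3).det) (curl G₀) (P z)
      simpa [Pi.smul_def] using this
    rw [e2, map_smul, smul_smul, hdet, one_smul]
  -- the infinitesimal identity for `v₀ = curl curl G₀`
  set v₀ : E3 → E3 := curl (curl G₀) with hv₀
  have hinf : ∀ y : E3, fderiv ℝ v₀ y (P (rotGen (P.symm y))) = P (rotGen (P.symm (v₀ y))) := by
    intro y
    have h1 := hax2.fderiv_rotGen (x := P.symm y) (hccGtd _)
    rw [hcurl2] at h1
    have h3 := fderiv_conj_linearIsometryEquiv P.symm v₀ (P.symm y)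
    simp only [LinearIsometryEquiv.symm_symm, LinearIsometryEquiv.apply_symm_apply] at h3
    rw [h3] at h1
    simp only [ContinuousLinearMap.comp_apply, LinearIsometryEquiv.coe_coe,
      ContinuousLinearEquiv.coe_coe, LinearIsometryEquiv.apply_symm_apply] at h1
    have h2 := congrArg P h1
    simpa using h2
  -- the shell is the translate of `v₀`
  have hshell : sepShellL H Y x₀ = fun x => v₀ (x + -x₀) := by
    have e0 : (fun x : E3 => (H ‖x - x₀‖ * Y (x - x₀)) • (x - x₀)) = fun x => G₀ (x + -x₀) := by
      funext x
      simp only [hG₀, ← sub_eq_add_neg, hHh _ (norm_nonneg _)]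
    unfold sepShellL
    rw [e0]
    have e1 : curl (fun x => G₀ (x + -x₀)) = fun x => curl G₀ (x + -x₀) := funext fun x => curl_comp_add_const G₀ (-x₀) x
    rw [e1]
    exact funext fun x => curl_comp_add_const (curl G₀) (-x₀) x
  intro x
  rw [hshell, fderiv_comp_add_right, ← sub_eq_add_neg, hinf (x - x₀)]
  simp [sub_eq_add_neg]

/-- ★ **Z⁺ `CoZonalShellAxisym` BY NAME** (support S of LINE g12-1): a two-shell whose solid harmonics are zonal about ONE common axis is an
axisymmetric slice about `x₀` — both shells satisfy the infinitesimal identity for the SAME generator `P ∘ rotGen ∘ P⁻¹`, which is linear in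
the field. -/
theorem coZonalShellAxisym_holds : CoZonalShellAxisym := by
  intro l₁ l₂ H₁ H₂ Y₁ Y₂ x₀ hY₁ hY₂ hH₁ hH₂ hco
  obtain ⟨a, ha, hz₁, hz₂⟩ := hco
  obtain ⟨⟨h₁, hh₁, hHh₁⟩, -⟩ := hH₁
  obtain ⟨⟨h₂, hh₂, hHh₂⟩, -⟩ := hH₂
  have han : ‖a‖ ≠ 0 := norm_ne_zero_iff.mpr ha
  have hn : ‖(‖a‖⁻¹ • a : E3)‖ = 1 := by rw [norm_smul, norm_inv, norm_norm, inv_mul_cancel₀ han]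
  obtain ⟨P, hP⟩ := exists_isometry_map_single_two (‖a‖⁻¹ • a) hn
  have hP' : P (e 2) = ‖a‖⁻¹ • a := by simpa [e] using hP
  have h1 := zonalShell_fderiv_generator x₀ hY₁ ha hz₁ hh₁ hHh₁ P hP'
  have h2 := zonalShell_fderiv_generator x₀ hY₂ ha hz₂ hh₂ hHh₂ P hP'
  have hd₁ : Differentiable ℝ (sepShellL H₁ Y₁ x₀) := (contDiff_top_sepShellL hh₁ hHh₁ hY₁ x₀).differentiable (by simp)
  have hd₂ : Differentiable ℝ (sepShellL H₂ Y₂ x₀) := (contDiff_top_sepShellL hh₂ hHh₂ hY₂ x₀).differentiable (by simp)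
  refine ⟨(P : E3 →L[ℝ] E3).comp (rotGenL.comp (P.symm : E3 →L[ℝ] E3)), fun x => ?_, ?_, fun x => ?_⟩
  · have e1 : ((P : E3 →L[ℝ] E3).comp (rotGenL.comp (P.symm : E3 →L[ℝ] E3))) x = P (rotGen (P.symm x)) := rfl
    rw [e1]
    calc ⟪P (rotGen (P.symm x)), x⟫_ℝ = ⟪P (rotGen (P.symm x)), P (P.symm x)⟫_ℝ := by
          rw [LinearIsometryEquiv.apply_symm_apply]
      _ = ⟪rotGen (P.symm x), P.symm x⟫_ℝ := LinearIsometryEquiv.inner_map_map P _ _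
      _ = 0 := inner_rotGen_self_zero _
  · intro h0
    have e1 : P (rotGen (EuclideanSpace.single (0 : Fin 3) (1:ℝ))) = 0 := by
      have := congrArg (fun B : E3 →L[ℝ] E3 => B (P (EuclideanSpace.single (0 : Fin 3) (1:ℝ)))) h0
      simpa using this
    have e2 : rotGen (EuclideanSpace.single (0 : Fin 3) (1:ℝ)) = 0 := P.injective (by rw [e1, map_zero])
    have e3 := congrArg (fun v : E3 => v 1) e2
    simp at e3
  · have e1 : ((P : E3 →L[ℝ] E3).comp (rotGenL.comp (P.symm : E3 →L[ℝ] E3))) (x - x₀) = P (rotGen (P.symm (x - x₀))) := rfl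
    rw [e1]
    show fderiv ℝ (fun x => sepShellL H₁ Y₁ x₀ x + sepShellL H₂ Y₂ x₀ x) x (P (rotGen (P.symm (x - x₀))))
        - P (rotGen (P.symm (sepShellL H₁ Y₁ x₀ x + sepShellL H₂ Y₂ x₀ x))) = 0
    rw [fderiv_fun_add (hd₁ x) (hd₂ x), _root_.add_apply, h1 x, h2 x]
    have hlin : ∀ u v : E3, rotGen (u + v) = rotGen u + rotGen v := fun u v => map_add rotGenL u v
    rw [map_add, hlin, map_add]
    abel

end Axisym

/-! ## LEMMA R: a solid harmonic of degree `≥ 1` whose rotation field vanishes near a point is zero -/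

section Radial

open scoped Topology InnerProductSpace
open Filter Set
open Literature.Analysis.FluidPDE (cross)

/-- a coordinate of the cross product (private copy). -/
private theorem cross_apply_zero (u v : E3) : cross u v 0 = u 1 * v 2 - u 2 * v 1 := by simp [cross, cross_apply]
/-- a coordinate of the cross product (private copy). -/
private theorem cross_apply_one (u v : E3) : cross u v 1 = u 2 * v 0 - u 0 * v 2 := by simp [cross, cross_apply]
/-- a coordinate of the cross product (private copy). -/
private theorem cross_apply_two (u v : E3) : cross u v 2 = u 0 * v 1 - u 1 * v 0 := by simp [cross, cross_apply]
/-- the inner product in coordinates (private copy). -/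
private theorem real_inner_e3 (u v : E3) : ⟪u, v⟫_ℝ = u 0 * v 0 + u 1 * v 1 + u 2 * v 2 := by
  simp [PiLp.inner_apply, Fin.sum_univ_three, mul_comm]

/-- `y × g = 0 ⇒ |y|² g = ⟪y,g⟫ y` (BAC–CAB), private copy. -/
private theorem smul_eq_of_cross_self_eq_zero {y g : E3} (h : cross y g = 0) : ⟪y, y⟫_ℝ • g = ⟪y, g⟫_ℝ • y := by
  have hc : ∀ i : Fin 3, cross y g i = 0 := fun i => by rw [h]; rfl
  have h0 := hc 0; have h1 := hc 1; have h2 := hc 2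
  rw [cross_apply_zero] at h0; rw [cross_apply_one] at h1; rw [cross_apply_two] at h2
  ext i
  fin_cases i <;> simp only [PiLp.smul_apply, smul_eq_mul, real_inner_e3] <;> simp
  · linear_combination (-(y 1)) * h2 + (y 2) * h1
  · linear_combination (y 0) * h2 - (y 2) * h0
  · linear_combination (-(y 0)) * h1 + (y 1) * h0

/-- ★ **LEMMA R**: if the rotation field `y × ∇Y(y)` of a solid harmonic of degree `l ≥ 1` vanishes on a neighbourhood of a point, then `Y ≡ 0`.
(On that neighbourhood `|y|²∇Y = lY·y`; differentiating and taking the trace gives `−l(l+1)Y = 0` there — Euler + `ΔY = 0` — and a solid harmonic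
vanishing on an open set vanishes identically by analyticity.) -/
theorem IsSolidHarmonic.eq_zero_of_rot_eventuallyEq_zero {l : ℕ} {Y : E3 → ℝ} (hY : IsSolidHarmonic l Y) (hl : 1 ≤ l) {y₀ : E3}
    (h : ∀ᶠ y in 𝓝 y₀, cross y (gradient Y y) = 0) : ∀ y, Y y = 0 := by
  -- the smooth field `F y = |y|² ∇Y − lY y` vanishes near `y₀`
  set F : E3 → E3 := fun y => ⟪y, y⟫_ℝ • gradient Y y - ((l : ℝ) * Y y) • y with hF
  have hF0 : F =ᶠ[𝓝 y₀] fun _ => 0 := by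
    filter_upwards [h] with y hy
    simp only [hF]
    rw [smul_eq_of_cross_self_eq_zero hy, hY.inner_self_gradient, sub_self]
  -- hence so does `Y` near `y₀`: differentiate `F` and take the trace
  have hYloc : ∀ᶠ y in 𝓝 y₀, Y y = 0 := by
    have hopen := h.eventually_nhds  -- `∀ᶠ y, ∀ᶠ z in 𝓝 y, cross z (∇Y z) = 0`
    filter_upwards [hF0.eventually_nhds] with y hy
    -- at `y`, `F` vanishes near `y`, so `fderiv F y = 0`
    have hfd : fderiv ℝ F y = 0 := by
      rw [Filter.EventuallyEq.fderiv_eq hy]; simp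
    -- the derivative of `F` computed
    have hg : HasFDerivAt (gradient Y) (fderiv ℝ (gradient Y) y) y :=
      ((hY.contDiff_gradient.differentiable (by simp)) y).hasFDerivAt
    have hYd : HasFDerivAt Y (fderiv ℝ Y y) y := ((hY.contDiff.differentiable (by simp)) y).hasFDerivAt
    have hn : HasFDerivAt (fun z : E3 => ⟪z, z⟫_ℝ) (2 • innerSL ℝ y) y := by
      have := (hasStrictFDerivAt_norm_sq y).hasFDerivAt
      simpa [real_inner_self_eq_norm_sq] using this
    have hF' : HasFDerivAt F ((⟪y, y⟫_ℝ • fderiv ℝ (gradient Y) y + (2 • innerSL ℝ y).smulRight (gradient Y y))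
        - (((l : ℝ) * Y y) • ContinuousLinearMap.id ℝ E3 + (((l : ℝ) • fderiv ℝ Y y)).smulRight y)) y := by
      have h1 := hn.smul hg
      have h2 := (hYd.const_mul (l : ℝ)).smul (hasFDerivAt_id y)
      exact h1.sub h2
    have hzero : ∀ v : E3, (⟪y, y⟫_ℝ • fderiv ℝ (gradient Y) y + (2 • innerSL ℝ y).smulRight (gradient Y y)
        - (((l : ℝ) * Y y) • ContinuousLinearMap.id ℝ E3 + (((l : ℝ) • fderiv ℝ Y y)).smulRight y)) v = 0 := by
      intro v
      have := congrArg (fun L : E3 →L[ℝ] E3 => L v) (hF'.fderiv.symm.trans hfd)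
      simpa only [_root_.zero_apply] using this
    -- trace over the standard basis, in coordinates
    have hfY : ∀ v, fderiv ℝ Y y v = ⟪gradient Y y, v⟫_ℝ := fun v => by
      rw [gradient, InnerProductSpace.toDual_symm_apply]
    have key : ∀ i : Fin 3, ‖y‖ ^ 2 * (fderiv ℝ (gradient Y) y (e i)) i + 2 * y i * (gradient Y y) i
        - ((l : ℝ) * Y y + (l : ℝ) * (gradient Y y) i * y i) = 0 := by
      intro i
      have he : ∀ w : E3, ⟪w, e i⟫_ℝ = w i := fun w => by
        rw [real_inner_e3]; fin_cases i <;> simp [e]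
      have hee : (e i : E3) i = 1 := by fin_cases i <;> simp [e]
      have hyy : ⟪y, y⟫_ℝ = ‖y‖ ^ 2 := real_inner_self_eq_norm_sq y
      have := congrArg (fun w : E3 => w i) (hzero (e i))
      simp only [sub_apply, add_apply, FunLike.coe_smul, Pi.smul_apply, ContinuousLinearMap.smulRight_apply,
        ContinuousLinearMap.id_apply, innerSL_apply_apply, PiLp.sub_apply, PiLp.add_apply, PiLp.smul_apply, smul_eq_mul,
        PiLp.zero_apply, hfY, he, hee, hyy, mul_one] at this
      linear_combination this
    have htr' : (fderiv ℝ (gradient Y) y (e 0)) 0 + (fderiv ℝ (gradient Y) y (e 1)) 1 + (fderiv ℝ (gradient Y) y (e 2)) 2 = 0 := by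
      have := hY.trace_hessian y
      have he : ∀ (j : Fin 3) (w : E3), ⟪w, e j⟫_ℝ = w j := fun j w => by
        rw [real_inner_e3]; fin_cases j <;> simp [e]
      simpa only [Fin.sum_univ_three, he] using this
    have hEul' : y 0 * (gradient Y y) 0 + y 1 * (gradient Y y) 1 + y 2 * (gradient Y y) 2 = (l : ℝ) * Y y := by
      have := hY.inner_self_gradient y
      rwa [real_inner_e3] at this
    have hnn : ‖y‖ ^ 2 = y 0 * y 0 + y 1 * y 1 + y 2 * y 2 := by rw [← real_inner_self_eq_norm_sq, real_inner_e3]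
    have hl1 : (0 : ℝ) < (l : ℝ) * ((l : ℝ) + 1) := by
      have : (1 : ℝ) ≤ l := by exact_mod_cast hl
      positivity
    have hmain : (l : ℝ) * ((l : ℝ) + 1) * Y y = 0 := by
      have k0 := key 0; have k1 := key 1; have k2 := key 2
      linear_combination (-1 : ℝ) * (k0 + k1 + k2) + ‖y‖ ^ 2 * htr' + (2 - (l : ℝ)) * hEul'
    exact (mul_eq_zero.mp hmain).resolve_left hl1.ne'
  -- analyticity: `Y` vanishes identically
  have hev : Y =ᶠ[𝓝 y₀] 0 := hYloc
  have := hY.analyticOnNhd.eqOn_zero_of_preconnected_of_eventuallyEq_zero isPreconnected_univ (mem_univ y₀) hev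
  exact fun y => this (mem_univ y)

end Radial

end Summit.NavierStokesRegularity.NavierStokesRegularity.Theorems.UnthreadedRigidity.CoZonal
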